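import Summits.AtomisticToContinuum.BoseEinsteinCondensation.Theorems.BECConjugateDominationInfraredMinimumUncertaintyFreeScaleKernelBound
import Summits.AtomisticToContinuum.BoseEinsteinCondensation.Theorems.BECConjugateDominationIMUChainGlue
import Summits.AtomisticToContinuum.BoseEinsteinCondensation.Theorems.BECConjugateDominationPositiveMinimiserFinal
import Summits.AtomisticToContinuum.BoseEinsteinCondensation.Theorems.BECConjugateDominationShortDistanceCoherence
import HarnessLib

/-!
# Route `BECConjugateDomination`, crux `InfraredMinimumUncertainty` (stmt-AtomisticToContinuum-11784):
# the floor-free, structure-factor-free law the route's deciding chain actually consumes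

Seat prover-line-stmt-AtomisticToContinuum-11784-c1-0 (line lead c1), 2026-08-16 — the constructive half of the
dead-line record of `fisher-gaussian-density-mode` ("what a surviving line must deliver").

The crux IMU (`N·ν_m·S_m ≤ C` for the positive torus minimiser; Lévy weight `ν_m = Re ĉ_m(log g)` of the
translation-averaged coherence `g`, uncentred structure factor `S_m`) enters the route ONLY through the glue
`IMUChainGlue` (stmt-11790, `Theorems.imuChainGlue_proof`), and there only paired with the crux `PuffFloor`
(`S_m ≥ ‖k‖/√(‖k‖² + Cρ)`) to produce the Lévy majorant `ν_m ≤ C₁/N + C₁√(C₂ρ)/(N‖k‖)` — a bound at the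
PHONON scale `√ρ/‖k‖` in the infrared.  This file isolates the weaker statement that already closes the chain:

* `LevyFreeScaleLaw` (LFL; a statement, not a fact): in the crux frame, `N·‖k‖²·ν_m ≤ C·(‖k‖² + ρ)` for
  every `m ≠ 0` — i.e. `ν_m ≤ C/N + Cρ/(N‖k‖²)`: Lévy weights at most of IDEAL-GAS size `ρ/(N‖k‖²)` in the
  infrared window `‖k‖ ≲ √ρ` and `O(1/N)` beyond it.  No structure factor, no sum-rule floor.
  (Bogoliubov: `N‖k‖²ν_k = ‖k‖²v_k²` has maximum `≈ 0.08·8πρa` at `‖k‖ ≈ 1/ξ`; `v ≡ 0`: `ν = 0`.)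
* `levyFreeScaleLaw_of_imu_of_puffFloor : InfraredMinimumUncertainty → PuffFloor → LevyFreeScaleLaw`
  (constant `C₁ + C₁C₂`; `‖k‖√(‖k‖²+C₂ρ) ≤ ‖k‖² + C₂ρ/2`): LFL is logically WEAKER than the pair of cruxes
  (in the window `‖k‖ ≤ √ρ` it allows `ν ≍ ρ/(N‖k‖²) ≫ √ρ/(N‖k‖)`).
* `smoothPeriodicBEC_of_levyFreeScaleLaw_of_supports :
    PositiveMinimiser → NearMinimiserStability → ShortDistanceCoherence → LevyFreeScaleLaw → SmoothPeriodicBEC`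
  — the glue re-run at the free scale: the Jensen–Parseval step now needs the `d = 3` lattice sum
  `∑_{m≠0}|η̂|²/‖m‖² ≤ (52 + 2Q₁/π²)·L/a` (`FreeScaleKernelBound.mul_exp_neg_le_setAverage_sq`), and the
  error is again `√ρ · D(v)` with `D = 512Q₀C(W+1)^{3/2} + (C/π²)(52 + 2Q₁/π²)√(W+1)`, `W = ‖ṽ‖₁`;
* `smoothPeriodicBEC_of_levyFreeScaleLaw : LevyFreeScaleLaw → NearMinimiserStability → SmoothPeriodicBEC`
  (the closed supports `PositiveMinimiser_proof`, `shortDistanceCoherence_proof` discharged).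

So the deciding chain `closes` of the route factors through ONE phase-side statement at the free scale:
`PuffFloor` and the structure factor are not on the critical path, and IMU's phonon-scale strength is unused.
Any line for this crux — or for a re-cruxed route — has to deliver exactly an `N`-uniform free-scale infrared
bound on the Lévy weights of the positive minimiser; that is the thermodynamic-limit statement of BEC strength
which the line `fisher-gaussian-density-mode` could only restate (`…LineCircularity.lean`).
Pure logic and arithmetic over landed theorems; one new statement `def`, no facts.
-/

noncomputable section

open MeasureTheory Set Filter Complex
open scoped ENNReal NNReal Topology ComplexConjugate

namespace Summit.AtomisticToContinuum.BoseEinsteinCondensation.Cruxes.InfraredMinimumUncertainty.FisherGaussianDensityMode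

open Literature.MathematicalPhysics.QuantumManyBody.BoseGas
open Summit.AtomisticToContinuum.BoseEinsteinCondensation.Theses.BECConjugateDomination
  (InfraredMinimumUncertainty PuffFloor PositiveMinimiser NearMinimiserStability ShortDistanceCoherence
    SmoothPeriodicBEC BoundaryTransferWeak HardCoreExtension)
open Summit.AtomisticToContinuum.BoseEinsteinCondensation.Theorems
  (PositiveMinimiser_proof shortDistanceCoherence_proof sideLength_pos sideLength_pow_three)
open Summit.AtomisticToContinuum.BoseEinsteinCondensation.Theorems.IMUChainGlue

/-- The fixed profile (local notation, as in the `IMUChainGlue` helper files). -/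
local notation "χ" => (ContDiffBump.normed
  (ContDiffBump.mk 1 2 one_pos one_lt_two : ContDiffBump (0 : Space)) volume)

/-- `Q₀ = ∫ χ²` (local notation). -/
local notation "Q₀" => ∫ y : Space, (χ y) ^ 2

/-- `Q₁ = ∑ⱼ ∫ |∂ⱼχ|²` (local notation). -/
local notation "Q₁" => ∑ j : Fin 3, ∫ y : Space, (fderiv ℝ χ y (EuclideanSpace.single j 1)) ^ 2

/-! ### The statement -/

/-- **LFL — the Lévy free-scale law** (a statement, not a fact; the floor-free, structure-factor-free
weakening of `InfraredMinimumUncertainty ∧ PuffFloor` that the route's glue consumes): for every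
smooth-class `v` there are `C ≥ 0`, `ρ₀ > 0` such that for `0 < ρ < ρ₀`, all large `N = n+1`, every
positive minimiser `Ψ` on the torus of side `(N/ρ)^{1/3}` and every `m ≠ 0`, with `k = 2πm/L`:
`N · ‖k‖² · ν_m ≤ C · (‖k‖² + ρ)`, i.e. `ν_m ≤ C/N + Cρ/(N‖k‖²)`. -/
def LevyFreeScaleLaw : Prop :=
  CruxFrame fun C ρ n Ψ => ∀ m : Fin 3 → ℤ, m ≠ 0 →
    ((n : ℝ) + 1) * ‖waveVec (sideLength ρ (n + 1)) m‖ ^ 2 * levyWeight n (sideLength ρ (n + 1)) Ψ m ≤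
      C * (‖waveVec (sideLength ρ (n + 1)) m‖ ^ 2 + ρ)

/-! ### LFL is implied by the pair of cruxes -/

/-- **`InfraredMinimumUncertainty ∧ PuffFloor ⇒ LevyFreeScaleLaw`**, constant `C₁ + C₁C₂`, `ρ₀ = min ρ₁ ρ₂`:
where `ν_m > 0`, `N‖k‖²ν = (NνS)·‖k‖²/S ≤ C₁‖k‖√(‖k‖²+C₂ρ) ≤ C₁(‖k‖² + C₂ρ/2)`. -/
theorem levyFreeScaleLaw_of_imu_of_puffFloor :
    InfraredMinimumUncertainty → PuffFloor → LevyFreeScaleLaw := by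
  intro hI hP v hv₁ hv₂ hv₃ hv₄
  obtain ⟨C₁, hC₁, ρ₁, hρ₁, h₁⟩ := hI v hv₁ hv₂ hv₃ hv₄
  obtain ⟨C₂, hC₂, ρ₂, hρ₂, h₂⟩ := hP v hv₁ hv₂ hv₃ hv₄
  refine ⟨C₁ + C₁ * C₂, by positivity, min ρ₁ ρ₂, lt_min hρ₁ hρ₂, fun ρ hρ hρ₀ => ?_⟩
  filter_upwards [h₁ ρ hρ (lt_of_lt_of_le hρ₀ (min_le_left _ _)),
    h₂ ρ hρ (lt_of_lt_of_le hρ₀ (min_le_right _ _))] with n hn₁ hn₂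
  set L : ℝ := sideLength ρ (n + 1) with hLdef
  intro Ψ hE hfin hreal hpos
  have hI' := hn₁ Ψ hE hfin hreal hpos
  have hP' := hn₂ Ψ hE hfin hreal hpos
  change ∀ m : Fin 3 → ℤ, m ≠ 0 → ((n : ℝ) + 1) * levyWeight n L Ψ m * structureFactor n L Ψ m ≤ C₁ at hI'
  change ∀ m : Fin 3 → ℤ, m ≠ 0 →
    ‖waveVec L m‖ / Real.sqrt (‖waveVec L m‖ ^ 2 + C₂ * ρ) ≤ structureFactor n L Ψ m at hP'
  intro m hm
  have hL : 0 < L := sideLength_pos hρ (n + 1) (Nat.succ_pos n)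
  set k : ℝ := ‖waveVec L m‖ with hk
  set ν : ℝ := levyWeight n L Ψ m with hνdef
  set S : ℝ := structureFactor n L Ψ m with hSdef
  have hkpos : 0 < k := norm_waveVec_pos hL hm
  have hsq : 0 < Real.sqrt (k ^ 2 + C₂ * ρ) := Real.sqrt_pos.2 (by positivity)
  have hIm := hI' m hm
  have hPm := hP' m hm
  have hSpos : 0 < S := lt_of_lt_of_le (div_pos hkpos hsq) hPm
  have h1 : ((n : ℝ) + 1) * ν ≤ C₁ / S := by
    rw [le_div_iff₀ hSpos]
    linarith
  have h1S : 1 / S ≤ Real.sqrt (k ^ 2 + C₂ * ρ) / k := by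
    rw [div_le_div_iff₀ hSpos hkpos, one_mul]
    rw [div_le_iff₀ hsq] at hPm
    rwa [mul_comm] at hPm
  have h2 : C₁ / S ≤ C₁ * (Real.sqrt (k ^ 2 + C₂ * ρ) / k) := by
    calc C₁ / S = C₁ * (1 / S) := by ring
      _ ≤ C₁ * (Real.sqrt (k ^ 2 + C₂ * ρ) / k) := by gcongr
  have h3 : k * Real.sqrt (k ^ 2 + C₂ * ρ) ≤ (k ^ 2 + (k ^ 2 + C₂ * ρ)) / 2 := by
    have hs := Real.sq_sqrt (show 0 ≤ k ^ 2 + C₂ * ρ by positivity)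
    nlinarith [sq_nonneg (k - Real.sqrt (k ^ 2 + C₂ * ρ)), Real.sqrt_nonneg (k ^ 2 + C₂ * ρ)]
  have hid : (C₁ + C₁ * C₂) * (k ^ 2 + ρ) - C₁ * ((k ^ 2 + (k ^ 2 + C₂ * ρ)) / 2) =
      C₁ * ρ + C₁ * C₂ * k ^ 2 + C₁ * C₂ * ρ / 2 := by ring
  have h4 : 0 ≤ C₁ * ρ + C₁ * C₂ * k ^ 2 + C₁ * C₂ * ρ / 2 := by positivity
  calc ((n : ℝ) + 1) * k ^ 2 * ν = k ^ 2 * (((n : ℝ) + 1) * ν) := by ring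
    _ ≤ k ^ 2 * (C₁ * (Real.sqrt (k ^ 2 + C₂ * ρ) / k)) :=
        mul_le_mul_of_nonneg_left (h1.trans h2) (sq_nonneg k)
    _ = C₁ * (k * Real.sqrt (k ^ 2 + C₂ * ρ)) := by field_simp
    _ ≤ C₁ * ((k ^ 2 + (k ^ 2 + C₂ * ρ)) / 2) := by gcongr
    _ ≤ (C₁ + C₁ * C₂) * (k ^ 2 + ρ) := by linarith

/-! ### The glue at the free scale -/

/-- **From LFL to the Lévy-weight bound of the free-scale glue**: if `N‖k‖²ν ≤ C₁(‖k‖² + ρ)` with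
`k = ‖waveVec L m‖ = (2π/L)‖m‖ > 0`, then `ν ≤ C₁/N + (C₁ρL²/(4π²N)) / ‖m‖²`. -/
theorem levy_bound_of_freeScaleLaw {L ρ C₁ N ν : ℝ} (hL : 0 < L) (hρ : 0 ≤ ρ)
    (hN : 0 < N) {m : Fin 3 → ℤ} (hm : m ≠ 0)
    (h : N * ‖waveVec L m‖ ^ 2 * ν ≤ C₁ * (‖waveVec L m‖ ^ 2 + ρ)) :
    ν ≤ C₁ / N + (C₁ * ρ * L ^ 2 / (4 * Real.pi ^ 2 * N)) / ‖latticeVec 1 m‖ ^ 2 := by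
  set k := ‖waveVec L m‖ with hk
  have hkpos : 0 < k := norm_waveVec_pos hL hm
  have hkm : k = 2 * Real.pi / L * ‖latticeVec 1 m‖ := by
    rw [hk, waveVec, norm_smul, Real.norm_of_nonneg (by positivity)]
  have hlv : 0 < ‖latticeVec 1 m‖ := norm_pos_iff.2 (latticeVec_one_ne_zero hm)
  have hν : ν ≤ C₁ * (k ^ 2 + ρ) / (N * k ^ 2) := by
    rw [le_div_iff₀ (by positivity)]
    linarith
  calc ν ≤ C₁ * (k ^ 2 + ρ) / (N * k ^ 2) := hν
    _ = C₁ / N + C₁ * ρ / (N * k ^ 2) := by field_simp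
    _ = C₁ / N + (C₁ * ρ * L ^ 2 / (4 * Real.pi ^ 2 * N)) / ‖latticeVec 1 m‖ ^ 2 := by
        rw [hkm]
        field_simp
        ring

/-- **The free-scale glue**: `PositiveMinimiser → NearMinimiserStability → ShortDistanceCoherence →
LevyFreeScaleLaw → SmoothPeriodicBEC`, with `c = ¼` — the route's `IMUChainGlue` re-run with the pair
`PuffFloor ∧ InfraredMinimumUncertainty` replaced by the single weaker `LevyFreeScaleLaw`; the only new input
is the free-scale Jensen–Parseval bound `mul_exp_neg_le_setAverage_sq` (lattice sum `∑|η̂|²/‖m‖² = O(L/a)`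
in `d = 3`). -/
theorem smoothPeriodicBEC_of_levyFreeScaleLaw_of_supports :
    PositiveMinimiser → NearMinimiserStability → ShortDistanceCoherence → LevyFreeScaleLaw →
      SmoothPeriodicBEC := by
  intro hPM hNMS hSDC hLFL v hv₁ hv₂ hv₃ hv₄
  -- the one crux
  obtain ⟨C₁, hC₁, ρ₁, hρ₁, hI⟩ := hLFL v hv₁ hv₂ hv₃ hv₄
  -- `W = ‖ṽ‖₁ < ∞`
  obtain ⟨R₀, hR₀⟩ := hv₁.2
  have hWtop : (∫⁻ x : Space, v ‖x‖) ≠ ⊤ := (lintegral_pot_lt_top hv₂ hv₃.continuous hR₀).ne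
  obtain ⟨W, hWdef⟩ : ∃ W : ℝ, W = (∫⁻ x : Space, v ‖x‖).toReal := ⟨_, rfl⟩
  have hW0 : 0 ≤ W := by rw [hWdef]; exact ENNReal.toReal_nonneg
  -- kernel constants and the error constant
  obtain ⟨q₀, hq₀⟩ : ∃ q : ℝ, q = Q₀ := ⟨_, rfl⟩
  obtain ⟨q₁, hq₁⟩ : ∃ q : ℝ, q = Q₁ := ⟨_, rfl⟩
  have hQ₀ : 0 ≤ q₀ := by rw [hq₀]; exact integral_nonneg fun y => sq_nonneg _
  have hQ₁ : 0 ≤ q₁ := by rw [hq₁]; exact Finset.sum_nonneg fun j _ => integral_nonneg fun y => sq_nonneg _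
  obtain ⟨D, hD⟩ : ∃ D : ℝ, D = 512 * q₀ * C₁ * (W + 1) * Real.sqrt (W + 1) +
    C₁ / Real.pi ^ 2 * (52 + 2 * q₁ / Real.pi ^ 2) * Real.sqrt (W + 1) := ⟨_, rfl⟩
  have hD0 : 0 ≤ D := by rw [hD]; positivity
  -- the density threshold
  refine ⟨min ρ₁ (1 / (9 * (D + 1) ^ 2)), lt_min hρ₁ (by positivity), ?_⟩
  intro ρ hρ hρlt
  have hρ₁' : ρ < ρ₁ := lt_of_lt_of_le hρlt (min_le_left _ _)
  have hρD : ρ < 1 / (9 * (D + 1) ^ 2) := lt_of_lt_of_le hρlt (min_le_right _ _)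
  -- the scales: `t = √((W+1)ρ)`, kernel radius `4a = 1/t`
  obtain ⟨t, ht⟩ : ∃ t : ℝ, t = Real.sqrt ((W + 1) * ρ) := ⟨_, rfl⟩
  have htpos : 0 < t := by rw [ht]; exact Real.sqrt_pos.2 (by positivity)
  have ht2 : t ^ 2 = (W + 1) * ρ := by rw [ht]; exact Real.sq_sqrt (by positivity)
  obtain ⟨a, ha⟩ : ∃ a : ℝ, a = 1 / (4 * t) := ⟨_, rfl⟩
  have hapos : 0 < a := by rw [ha]; positivity
  have h4a : 4 * a = 1 / t := by rw [ha]; field_simp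
  -- the error is `√ρ · D ≤ 1/3`
  have hsqρ : Real.sqrt ρ * (D + 1) < 1 / 3 := by
    have h1 : Real.sqrt ρ < Real.sqrt (1 / (9 * (D + 1) ^ 2)) := Real.sqrt_lt_sqrt hρ.le hρD
    have h2 : Real.sqrt (1 / (9 * (D + 1) ^ 2)) = 1 / (3 * (D + 1)) := by
      rw [show (1 : ℝ) / (9 * (D + 1) ^ 2) = (1 / (3 * (D + 1))) ^ 2 by field_simp; norm_num,
        Real.sqrt_sq (by positivity)]
    rw [h2] at h1
    have := mul_lt_mul_of_pos_right h1 (by positivity : 0 < D + 1)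
    rwa [div_mul_eq_mul_div, one_mul, mul_comm (3 : ℝ), ← div_div, div_self (by positivity)] at this
  refine ⟨1 / 4, by norm_num, ?_⟩
  -- large `N`: the crux holds and the kernel fits into the cell (`4a ≤ L ⟸ N ≥ ρ/t³`)
  have hev := (hI ρ hρ hρ₁').and (eventually_ge_atTop ⌈ρ / t ^ 3⌉₊)
  rw [Filter.eventually_atTop] at hev ⊢
  obtain ⟨n₀, hn₀⟩ := hev
  refine ⟨n₀ + 1, fun N hN => ?_⟩
  obtain ⟨n, rfl⟩ : ∃ n, N = n + 1 := ⟨N - 1, by omega⟩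
  obtain ⟨hIn, hNn⟩ := hn₀ n (by omega)
  -- the box
  set L : ℝ := sideLength ρ (n + 1) with hLdef
  have hL : 0 < L := sideLength_pos hρ (n + 1) (Nat.succ_pos n)
  have hL3 : L ^ 3 = ((n : ℝ) + 1) / ρ := by
    rw [hLdef, sideLength_pow_three hρ (n + 1) (Nat.succ_pos n)]; push_cast; rfl
  have hNpos : (0 : ℝ) < (n : ℝ) + 1 := by positivity
  -- `4a ≤ L`
  have h4aL : 4 * a ≤ L := by
    rw [h4a]
    have hN' : ρ / t ^ 3 ≤ (n : ℝ) + 1 := by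
      have := (Nat.le_ceil (ρ / t ^ 3)).trans (by exact_mod_cast hNn : (⌈ρ / t ^ 3⌉₊ : ℝ) ≤ n)
      linarith
    have hcube : (1 / t) ^ 3 ≤ L ^ 3 := by
      rw [hL3, le_div_iff₀ hρ]
      calc (1 / t) ^ 3 * ρ = ρ / t ^ 3 := by ring
        _ ≤ (n : ℝ) + 1 := hN'
    exact le_of_pow_le_pow_left₀ (by norm_num) hL.le hcube
  -- the positive minimiser
  obtain ⟨Ψ, hE, hfin, -, hreal, hpos⟩ := hPM v hv₁ hv₂ hv₃ hv₄ n L hL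
  -- the crux at `Ψ`
  have hI' := hIn Ψ hE hfin hreal hpos
  -- the Lévy-weight bound in the free-scale glue's form
  obtain ⟨B₁, hB₁⟩ : ∃ B : ℝ, B = C₁ / ((n : ℝ) + 1) := ⟨_, rfl⟩
  obtain ⟨B₃, hB₃⟩ : ∃ B : ℝ, B = C₁ * ρ * L ^ 2 / (4 * Real.pi ^ 2 * ((n : ℝ) + 1)) := ⟨_, rfl⟩
  have hB₁0 : 0 ≤ B₁ := by rw [hB₁]; positivity
  have hB₃0 : 0 ≤ B₃ := by rw [hB₃]; positivity
  -- the coherence `g`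
  obtain ⟨g, hg⟩ : ∃ g : Space → ℝ, g = coherence n L Ψ := ⟨_, rfl⟩
  have hgc : Continuous g := by rw [hg]; exact continuous_coherence Ψ
  have hgpos : ∀ r, 0 < g r := by rw [hg]; exact coherence_pos Ψ hpos
  have hν : ∀ m : Fin 3 → ℤ, m ≠ 0 →
      (cellFourierCoeff L (fun r : Space => ((Real.log (g r) : ℝ) : ℂ)) m).re ≤
        B₁ + B₃ / ‖latticeVec 1 m‖ ^ 2 := by
    intro m hm
    rw [hg, hB₁, hB₃]
    exact levy_bound_of_freeScaleLaw hL hρ.le hNpos hm (hI' m hm)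
  -- step (iv): `g ≥ 3/4` within `4a` of the lattice
  have hT := lintegral_kineticDensity_le_of_isMinimiser hL hv₁.1 Ψ hE
  have hTtop : (∫⁻ X in cellN (n + 1) L, kineticDensity Ψ.ψ X) ≠ ⊤ := by
    refine ne_top_of_le_ne_top ?_ hT
    refine ENNReal.mul_ne_top (by simp) (ENNReal.mul_ne_top (ENNReal.inv_ne_top.2 ?_) hWtop)
    exact pow_ne_zero _ (by simpa using hL)
  have hTreal : (∫⁻ X in cellN (n + 1) L, kineticDensity Ψ.ψ X).toReal ≤
      ((n : ℝ) + 1) ^ 2 / 2 * ((L ^ 3)⁻¹ * W) := by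
    have h1 := ENNReal.toReal_mono (ENNReal.mul_ne_top (by simp)
      (ENNReal.mul_ne_top (ENNReal.inv_ne_top.2 (pow_ne_zero _ (by simpa using hL))) hWtop)) hT
    rw [ENNReal.toReal_mul, ENNReal.toReal_mul, ENNReal.toReal_inv, ENNReal.toReal_pow,
      ENNReal.toReal_ofReal hL.le, ENNReal.toReal_natCast, ← hWdef] at h1
    refine h1.trans (mul_le_mul_of_nonneg_right ?_ (by positivity))
    have := Nat.choose_le_pow_div 2 (n + 1) (α := ℝ)
    simp only [Nat.factorial_two, Nat.cast_ofNat] at this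
    push_cast at this
    exact this
  have hnear : ∀ r : Space, (∃ ε ∈ (Fintype.piFinset fun _ : Fin 3 => ({0, 1} : Finset ℤ)),
      ‖r - latticeVec L ε‖ < 4 * a) → 3 / 4 ≤ g r := by
    rintro r ⟨ε, -, hε⟩
    have hper : g r = g (r - latticeVec L ε) := by
      rw [hg, ← coherence_add_latticeVec Ψ (r - latticeVec L ε) ε, sub_add_cancel]
    rw [hper]
    have hS := hSDC n L hL Ψ hTtop (r - latticeVec L ε)
    change _ ≤ coherence n L Ψ (r - latticeVec L ε) at hS
    rw [← hg] at hS
    refine le_trans ?_ hS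
    have hr4 : ‖r - latticeVec L ε‖ ^ 2 ≤ (4 * a) ^ 2 := by
      exact pow_le_pow_left₀ (norm_nonneg _) hε.le 2
    have hkey : (4 * a) ^ 2 * (((n : ℝ) + 1) ^ 2 / 2 * ((L ^ 3)⁻¹ * W)) / (2 * ((n : ℝ) + 1)) ≤ 1 / 4 := by
      rw [h4a, hL3]
      rw [div_le_iff₀ (by positivity)]
      have hW1 : W / (W + 1) ≤ 1 := by rw [div_le_one (by positivity)]; linarith
      have : (1 / t) ^ 2 * (((n : ℝ) + 1) ^ 2 / 2 * ((((n : ℝ) + 1) / ρ)⁻¹ * W)) =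
          ((n : ℝ) + 1) / 2 * (W / (W + 1)) := by
        field_simp
        rw [ht2]
        ring
      rw [this]
      have h3 := mul_le_mul_of_nonneg_left hW1 (by positivity : (0 : ℝ) ≤ ((n : ℝ) + 1) / 2)
      linarith
    have hTn : 0 ≤ (∫⁻ X in cellN (n + 1) L, kineticDensity Ψ.ψ X).toReal := ENNReal.toReal_nonneg
    calc (3 : ℝ) / 4 = 1 - 1 / 4 := by norm_num
      _ ≤ 1 - (4 * a) ^ 2 * (((n : ℝ) + 1) ^ 2 / 2 * ((L ^ 3)⁻¹ * W)) / (2 * ((n : ℝ) + 1)) := by linarith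
      _ ≤ 1 - ‖r - latticeVec L ε‖ ^ 2 * (∫⁻ X in cellN (n + 1) L, kineticDensity Ψ.ψ X).toReal /
            (2 * ((n : ℝ) + 1)) := by
          rw [sub_le_sub_iff_left]
          exact div_le_div_of_nonneg_right (mul_le_mul hr4 hTreal hTn (sq_nonneg _)) (by positivity)
  -- steps (ii),(iii),(v): the Lévy–Jensen–Parseval bound at the free scale
  have hJ := mul_exp_neg_le_setAverage_sq hL hapos h4aL (by norm_num : (0 : ℝ) < 3 / 4) hB₁0 hB₃0 hgc
    hgpos hnear hν
  rw [← hq₀, ← hq₁] at hJ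
  -- the error is `√ρ · D ≤ 1/3`
  have hErr : B₁ * (8 * q₀ * L ^ 3 / a ^ 3) + B₃ * ((52 + 2 * q₁ / Real.pi ^ 2) * L / a) ≤ 1 / 3 := by
    have hsqρ0 : 0 ≤ Real.sqrt ρ := Real.sqrt_nonneg ρ
    have htsplit : t = Real.sqrt (W + 1) * Real.sqrt ρ := by rw [ht, Real.sqrt_mul (by positivity)]
    have hT1 : B₁ * (8 * q₀ * L ^ 3 / a ^ 3) = 512 * q₀ * C₁ * (W + 1) * Real.sqrt (W + 1) * Real.sqrt ρ := by
      have h1 : B₁ * (8 * q₀ * L ^ 3 / a ^ 3) = 512 * q₀ * C₁ * (t ^ 2 * t) / ρ := by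
        rw [hB₁, ha, hL3]; field_simp; ring
      rw [h1, ht2]
      field_simp
      rw [htsplit]
      ring
    have hT2 : B₃ * ((52 + 2 * q₁ / Real.pi ^ 2) * L / a) =
        C₁ / Real.pi ^ 2 * (52 + 2 * q₁ / Real.pi ^ 2) * Real.sqrt (W + 1) * Real.sqrt ρ := by
      have hpi : Real.pi ≠ 0 := Real.pi_ne_zero
      have htne : t ≠ 0 := htpos.ne'
      have hNne : ((n : ℝ) + 1) ≠ 0 := hNpos.ne'
      have h1 : B₃ * ((52 + 2 * q₁ / Real.pi ^ 2) * L / a) =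
          C₁ * (52 + 2 * q₁ / Real.pi ^ 2) * t / Real.pi ^ 2 * (ρ * L ^ 3 / ((n : ℝ) + 1)) := by
        rw [hB₃, ha]
        field_simp
      have h2 : ρ * L ^ 3 / ((n : ℝ) + 1) = 1 := by
        rw [hL3]
        field_simp
      rw [h1, h2, mul_one, htsplit]
      ring
    rw [hT1, hT2]
    have : 512 * q₀ * C₁ * (W + 1) * Real.sqrt (W + 1) * Real.sqrt ρ +
        C₁ / Real.pi ^ 2 * (52 + 2 * q₁ / Real.pi ^ 2) * Real.sqrt (W + 1) * Real.sqrt ρ =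
        Real.sqrt ρ * D := by rw [hD]; ring
    rw [this]
    nlinarith [hsqρ, hsqρ0, hD0]
  -- hence `L⁻³ ∫ g ≥ 1/2`
  have havg : 1 / 2 ≤ (L ^ 3)⁻¹ * ∫ r in cell L, g r := by
    refine le_trans ?_ hJ
    have hexp : 2 / 3 ≤ Real.exp (-(B₁ * (8 * q₀ * L ^ 3 / a ^ 3) +
        B₃ * ((52 + 2 * q₁ / Real.pi ^ 2) * L / a))) := by
      have := Real.add_one_le_exp (-(B₁ * (8 * q₀ * L ^ 3 / a ^ 3) +
        B₃ * ((52 + 2 * q₁ / Real.pi ^ 2) * L / a)))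
      linarith
    linarith [hexp]
  -- step (i): `n₀(Ψ) ≥ N/2`
  have hn₀ : ENNReal.ofReal (((n : ℝ) + 1) / 2) ≤ condensateOccupation (n + 1) L Ψ.ψ := by
    rw [condensateOccupation_eq_ofReal_integral_coherence Ψ hreal, ← hg]
    refine ENNReal.ofReal_le_ofReal ?_
    have := mul_le_mul_of_nonneg_left havg hNpos.le
    linarith
  -- step (vi): stability of the condensate under `δ`-perturbations of the energy
  have hE₀top : periodicGroundStateEnergy v (n + 1) L ≠ ⊤ := hE ▸ hfin
  obtain ⟨δ, hδ, hstab⟩ := hNMS v hv₁ hv₂ hv₃ hv₄ (n + 1) L hL hE₀top (1 / 4) (by norm_num)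
  refine ⟨δ, hδ, fun Φ hΦ => ?_⟩
  have h := (hn₀.trans (hstab Ψ Φ hE hΦ))
  have hq : ENNReal.ofReal (((n : ℝ) + 1) / 2) =
      ENNReal.ofReal (1 / 4 * ((n + 1 : ℕ) : ℝ)) + ENNReal.ofReal (1 / 4 * ((n + 1 : ℕ) : ℝ)) := by
    rw [← ENNReal.ofReal_add (by positivity) (by positivity)]
    congr 1
    push_cast
    ring
  rw [hq] at h
  exact (ENNReal.add_le_add_iff_right ENNReal.ofReal_ne_top).1 h

/-- **The route's deciding chain factors through the free-scale law**: with the closed supports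
`PositiveMinimiser_proof` (stmt-11787) and `shortDistanceCoherence_proof` (stmt-11789) discharged,
`LevyFreeScaleLaw → NearMinimiserStability → SmoothPeriodicBEC`. Compare `smoothPeriodicBEC_of_imu`
(`…LineCircularity.lean`): there the hypotheses are `InfraredMinimumUncertainty → PuffFloor → …`; by
`levyFreeScaleLaw_of_imu_of_puffFloor` this theorem implies that one. -/
theorem smoothPeriodicBEC_of_levyFreeScaleLaw :
    LevyFreeScaleLaw → NearMinimiserStability → SmoothPeriodicBEC := fun hL hN =>
  smoothPeriodicBEC_of_levyFreeScaleLaw_of_supports PositiveMinimiser_proof hN shortDistanceCoherence_proof hL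

-- Consistency: `fun hI hP hN => smoothPeriodicBEC_of_levyFreeScaleLaw (levyFreeScaleLaw_of_imu_of_puffFloor hI hP) hN`
-- re-proves `smoothPeriodicBEC_of_imu` of `…LineCircularity.lean` (same statement; not re-declared here).

/-- **The route as a conditional bridge, with the weaker hypothesis**: the deciding theorem `closes` of route
`BECConjugateDomination` with `InfraredMinimumUncertainty ∧ PuffFloor` replaced by `LevyFreeScaleLaw` (and the
three closed items discharged) — `LevyFreeScaleLaw → BoundaryTransferWeak → HardCoreExtension →
NearMinimiserStability → BoseEinsteinCondensation` (the sub-problem Statement, by name). -/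
theorem boseEinsteinCondensation_of_levyFreeScaleLaw :
    LevyFreeScaleLaw → BoundaryTransferWeak → HardCoreExtension → NearMinimiserStability →
      _root_.BoseEinsteinCondensation := fun hL hBT hHC hN =>
  hHC (fun v a b c d => hBT v a (smoothPeriodicBEC_of_levyFreeScaleLaw hL hN v a b c d))

end Summit.AtomisticToContinuum.BoseEinsteinCondensation.Cruxes.InfraredMinimumUncertainty.FisherGaussianDensityMode

end
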